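import Mathlib
import Summits.Ventures.PercRepro2.SwOutShadowMultiRootIneq

/-!
# The frozen base: a decorated multi-root cube with a FROZEN part (blind cell PercRepro2, night-4
g38, 2026-08-29; proofs/NIGHT4-G38.md §2; the blueprint NIGHT4-G36.md §6 (a′))

The blocks of the impure frontier (design 19 of mining/night-4/g36/shadow19.py — FROZEN UNITS: the
block of a side point is the cube over its MOVABLE units only) are cubes of g35's decorated kind
whose background contains a FROZEN part `Fz` inside the hull region `H`: the blue arms of the block
with their decorations, attached to the roots in BLUE, never flipped.  `FrozenBaseE` is g35's
`DecoBaseE` with that part: the roots' edges go to roots, movable arms or `Fz` (red to a root or an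
arm, blue to `Fz`), no edge joins a movable arm to `Fz`, the movable units are pairwise disjoint
with no edge between two of them, the decorations lie outside `H`.  Nothing is assumed about the
edges at a decoration vertex (they may see bystanders, `Fz`, `l`: the impurity of the frontier) nor
about the edges inside `Fz` — the weak cube principle of g36 (`card_le_of_cube_edges_weak`) needs
only the red edge set of `h` increasing and the antipode containment at the side points, and both
are theorems of this structure alone (SwOutFrozenBaseMono).

The realisation of a cube point is g35's `decoRealRR` (the union flip of the units assigned
`false`, the root–root edges assigned `false` negated): `Fz` is in no unit, so it is never flipped,
and an edge between a movable unit and `Fz` toggles with the unit.  This file: the structure, the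
unit facts and the value of a realisation on every kind of edge.
-/

namespace Summit.Ventures.PercRepro2

namespace LocRows

open Hull

variable {V : Type*} {E : Type*}

open scoped Classical

variable {ends : E → Sym2 V}

/-- **The data of a frozen base**: roots `R`, movable arms `A i` with decorations `Z i`, root–root
edges `RR`, a frozen part `Fz` — all inside the hull region `H` except the decorations and `l`.
Edges at a root go to a root, a movable arm (red) or `Fz` (blue); an edge from `H` to its outside
is blue; no edge joins a movable arm to `Fz`; the movable units `A i ∪ Z i` are pairwise disjoint
and no edge joins two of them; every movable arm vertex lies on an edge (injectivity). -/
structure FrozenBaseE (ends : E → Sym2 V) (ζ : Config E) (R : Set V) (H : Set V) (l : V)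
    {ι : Type*} (A Z : ι → Set V) (RR : Finset E) (Fz : Set V) : Prop where
  root_sub : R ⊆ H
  fz_sub : Fz ⊆ H
  fz_notMem_root : ∀ z ∈ Fz, z ∉ R
  bdry_blue : ∀ e x y, ends e = s(x, y) → x ∈ H → y ∉ H → ζ e = false
  arm_sub : ∀ i, ∀ x ∈ A i, x ∈ H ∧ x ∉ R ∧ x ∉ Fz
  arm_nonempty : ∀ i, (A i).Nonempty
  arm_edge : ∀ i, ∀ x ∈ A i, ∃ e, x ∈ ends e
  arm_disj : ∀ i j, i ≠ j → ∀ x, x ∈ A i → x ∉ A j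
  arm_cover : ∀ x ∈ H, x ∉ R → x ∉ Fz → ∃ i, x ∈ A i
  root_edges : ∀ e r x, r ∈ R → ends e = s(r, x) → x ∈ R ∨ (∃ i, x ∈ A i) ∨ x ∈ Fz
  loop_root : ∀ e r, r ∈ R → ends e ≠ s(r, r)
  root_red : ∀ e r x, r ∈ R → ends e = s(r, x) → x ∉ Fz → ζ e = true
  root_fz_blue : ∀ e r x, r ∈ R → ends e = s(r, x) → x ∈ Fz → ζ e = false
  rr_iff : ∀ e, e ∈ RR ↔ ∃ r ∈ R, ∃ r' ∈ R, ends e = s(r, r')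
  no_arm_fz : ∀ e x y, ends e = s(x, y) → (∃ i, x ∈ A i) → y ∉ Fz
  l_notMem : l ∉ H
  deco_notMem : ∀ i, ∀ z ∈ Z i, z ∉ H
  deco_ne_l : ∀ i, l ∉ Z i
  deco_disj : ∀ i j, i ≠ j → ∀ z, z ∈ Z i → z ∉ Z j
  no_cross : ∀ i j, i ≠ j → ∀ e x y, ends e = s(x, y) → x ∈ unitAZ A Z i → y ∈ unitAZ A Z j →
    False

section Base

variable {ι : Type*} {A Z : ι → Set V} {ζ : Config E} {R H : Set V} {l : V} {RR : Finset E}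
  {Fz : Set V} (hb : FrozenBaseE ends ζ R H l A Z RR Fz)
include hb

/-- A root lies in no movable arm. -/
lemma FrozenBaseE.root_notMem_arm {r : V} (hr : r ∈ R) (i : ι) : r ∉ A i :=
  fun h' => (hb.arm_sub i r h').2.1 hr

/-- A decoration vertex lies in no arm. -/
lemma FrozenBaseE.deco_notMem_arm {i j : ι} {z : V} (hz : z ∈ Z i) : z ∉ A j :=
  fun h' => hb.deco_notMem i z hz (hb.arm_sub j z h').1

/-- A decoration vertex is not frozen. -/
lemma FrozenBaseE.deco_notMem_fz {i : ι} {z : V} (hz : z ∈ Z i) : z ∉ Fz :=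
  fun h' => hb.deco_notMem i z hz (hb.fz_sub h')

/-- A frozen vertex lies in no unit. -/
lemma FrozenBaseE.fz_notMem_unit {z : V} (hz : z ∈ Fz) (i : ι) : z ∉ unitAZ A Z i := by
  rintro (h' | h')
  · exact (hb.arm_sub i z h').2.2 hz
  · exact hb.deco_notMem i z h' (hb.fz_sub hz)

/-- A root lies in no unit. -/
lemma FrozenBaseE.root_notMem_unit {r : V} (hr : r ∈ R) (i : ι) : r ∉ unitAZ A Z i := by
  rintro (h' | h')
  · exact hb.root_notMem_arm hr i h'
  · exact hb.deco_notMem i r h' (hb.root_sub hr)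

/-- `l` lies in no unit. -/
lemma FrozenBaseE.l_notMem_unit (i : ι) : l ∉ unitAZ A Z i := by
  rintro (h' | h')
  · exact hb.l_notMem (hb.arm_sub i l h').1
  · exact hb.deco_ne_l i h'

/-- **Units are pairwise disjoint.** -/
lemma FrozenBaseE.unit_disj {i j : ι} (hij : i ≠ j) {x : V} (hx : x ∈ unitAZ A Z i) :
    x ∉ unitAZ A Z j := by
  rintro (h' | h')
  · rcases hx with hx | hx
    · exact hb.arm_disj i j hij x hx h'
    · exact hb.deco_notMem_arm hx h'
  · rcases hx with hx | hx
    · exact hb.deco_notMem_arm h' hx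
    · exact hb.deco_disj i j hij x hx h'

/-- **The two ends of an edge in units lie in the same unit.** -/
lemma FrozenBaseE.unit_eq_of_edge {i j : ι} {e : E} {x y : V} (hxy : ends e = s(x, y))
    (hx : x ∈ unitAZ A Z i) (hy : y ∈ unitAZ A Z j) : i = j := by
  by_contra hij
  exact hb.no_cross i j hij e x y hxy hx hy

/-- An edge with an end in a unit is not a root–root edge. -/
lemma FrozenBaseE.notMem_rr_of_mem_unit {e : E} {x y : V} (hxy : ends e = s(x, y)) {i : ι}
    (hx : x ∈ unitAZ A Z i) : e ∉ RR := by
  intro he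
  obtain ⟨r, hr, r', hr', hrr⟩ := (hb.rr_iff e).1 he
  rw [hxy, Sym2.eq_iff] at hrr
  rcases hrr with ⟨rfl, -⟩ | ⟨rfl, -⟩
  · exact hb.root_notMem_unit hr i hx
  · exact hb.root_notMem_unit hr' i hx

/-- A root–root edge is the edge of two roots. -/
lemma FrozenBaseE.mem_rr {e : E} {r r' : V} (hr : r ∈ R) (hr' : r' ∈ R)
    (hrr : ends e = s(r, r')) : e ∈ RR :=
  (hb.rr_iff e).2 ⟨r, hr, r', hr', hrr⟩

/-- An edge with an end that is no root is no root–root edge. -/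
lemma FrozenBaseE.notMem_rr_of_notMem_R {e : E} {x y : V} (hxy : ends e = s(x, y))
    (hx : x ∉ R) : e ∉ RR := by
  intro he
  obtain ⟨r, hr, r', hr', hrr⟩ := (hb.rr_iff e).1 he
  rw [hxy, Sym2.eq_iff] at hrr
  rcases hrr with ⟨rfl, -⟩ | ⟨rfl, -⟩
  · exact hx hr
  · exact hx hr'

/-- An edge with an end in the unit `i` touches the units assigned `false` iff `ω i = false`. -/
lemma FrozenBaseE.touches_unitsFalse_iff {ω : Config ι} {i : ι} {e : E} {x y : V}
    (hxy : ends e = s(x, y)) (hx : x ∈ unitAZ A Z i) :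
    e ∈ touches ends (armsFalseC (unitAZ A Z) ω) ↔ ω i = false := by
  constructor
  · rintro ⟨z, ⟨j, hj, hz⟩, w, hzw⟩
    rw [hxy, Sym2.eq_iff] at hzw
    rcases hzw with ⟨h1, _⟩ | ⟨_, h2⟩
    · rw [← h1] at hz
      have hji : j = i := by
        by_contra hne
        exact hb.unit_disj hne hz hx
      rw [← hji]; exact hj
    · rw [← h2] at hz
      have hij : i = j := hb.unit_eq_of_edge hxy hx hz
      rw [hij]; exact hj
  · intro hi
    exact ⟨x, ⟨i, hi, hx⟩, y, hxy⟩

/-- **The value of a realisation on an edge with an end in the unit `i`.** -/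
lemma FrozenBaseE.decoRealRR_apply_of_mem {ω : Config (ι ⊕ ↥RR)} {i : ι} {e : E} {x y : V}
    (hxy : ends e = s(x, y)) (hx : x ∈ unitAZ A Z i) :
    decoRealRR ends A Z RR ζ ω e = (if ω (Sum.inl i) = true then ζ e else !ζ e) := by
  rw [decoRealRR_apply_of_notMem_rr (hb.notMem_rr_of_mem_unit hxy hx)]
  by_cases hi : ω (Sum.inl i) = true
  · rw [flip_apply_of_notMem, if_pos hi]
    rw [hb.touches_unitsFalse_iff hxy hx]; simp [armPart, hi]
  · rw [flip_apply_of_mem, if_neg hi]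
    rw [hb.touches_unitsFalse_iff hxy hx]
    simpa [armPart] using hi

/-- An edge at a root with its other end in `A i` is red at a cube point iff `ω (inl i) = true`. -/
lemma FrozenBaseE.decoRealRR_root_edge {ω : Config (ι ⊕ ↥RR)} {i : ι} {e : E} {r x : V}
    (hr : r ∈ R) (hrx : ends e = s(r, x)) (hx : x ∈ A i) :
    decoRealRR ends A Z RR ζ ω e = true ↔ ω (Sum.inl i) = true := by
  rw [hb.decoRealRR_apply_of_mem (ends_swap hrx) (Or.inl hx),
    hb.root_red e r x hr hrx (hb.arm_sub i x hx).2.2]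
  by_cases hi : ω (Sum.inl i) = true <;> simp [hi]

/-- A root–root edge is red at a cube point iff its coordinate is `true`. -/
lemma FrozenBaseE.decoRealRR_rr_edge {ω : Config (ι ⊕ ↥RR)} {e : E} (he : e ∈ RR) :
    decoRealRR ends A Z RR ζ ω e = true ↔ ω (Sum.inr ⟨e, he⟩) = true := by
  obtain ⟨r, hr, r', hr', hrr⟩ := (hb.rr_iff e).1 he
  rw [decoRealRR_apply_rr he, hb.root_red e r r' hr hrr (fun h' => hb.fz_notMem_root r' h' hr')]
  by_cases hi : ω (Sum.inr ⟨e, he⟩) = true <;> simp [hi]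

/-- An edge from `A i` to the outside of `H` is red at a cube point iff `ω (inl i) = false`. -/
lemma FrozenBaseE.decoRealRR_out_edge {ω : Config (ι ⊕ ↥RR)} {i : ι} {e : E} {x y : V}
    (hxy : ends e = s(x, y)) (hx : x ∈ A i) (hy : y ∉ H) :
    decoRealRR ends A Z RR ζ ω e = true ↔ ω (Sum.inl i) = false := by
  rw [hb.decoRealRR_apply_of_mem hxy (Or.inl hx), hb.bdry_blue e x y hxy (hb.arm_sub i x hx).1 hy]
  by_cases hi : ω (Sum.inl i) = true <;> simp [hi]

/-- An edge from a root to a frozen vertex is blue at every cube point. -/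
lemma FrozenBaseE.decoRealRR_root_fz_edge {ω : Config (ι ⊕ ↥RR)} {e : E} {r z : V} (hr : r ∈ R)
    (hrz : ends e = s(r, z)) (hz : z ∈ Fz) : decoRealRR ends A Z RR ζ ω e = false := by
  rw [DecoBaseE.decoRealRR_apply_of_notMem]
  · exact hb.root_fz_blue e r z hr hrz hz
  · rintro ⟨x, ⟨i, hx⟩, y, hxy⟩
    rw [hrz, Sym2.eq_iff] at hxy
    rcases hxy with ⟨rfl, -⟩ | ⟨-, rfl⟩
    · exact hb.root_notMem_unit hr i hx
    · exact hb.fz_notMem_unit hz i hx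
  · exact hb.notMem_rr_of_notMem_R (ends_swap hrz) (hb.fz_notMem_root z hz)

/-- A vertex adjacent to a root is a root, lies in a movable arm, or is frozen. -/
lemma FrozenBaseE.root_edges' {e : E} {r x : V} (hr : r ∈ R) (hrx : ends e = s(r, x)) :
    x ∈ R ∨ (∃ i, x ∈ A i) ∨ x ∈ Fz :=
  hb.root_edges e r x hr hrx

/-- **The realisation is injective.** -/
theorem FrozenBaseE.decoRealRR_injective : Function.Injective (decoRealRR ends A Z RR ζ) := by
  intro ω ω' heq
  funext i
  rcases i with i | ⟨e, he⟩
  · obtain ⟨x, hx⟩ := hb.arm_nonempty i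
    obtain ⟨e, hxe⟩ := hb.arm_edge i x hx
    have hxy : ends e = s(x, Sym2.Mem.other hxe) := (Sym2.other_spec hxe).symm
    have h1 := hb.decoRealRR_apply_of_mem (ω := ω) hxy (Or.inl hx)
    have h2 := hb.decoRealRR_apply_of_mem (ω := ω') hxy (Or.inl hx)
    rw [heq] at h1
    rw [h1] at h2
    by_contra hne
    have key : ∀ b b' : Bool, b ≠ b' →
        (if b = true then ζ e else !ζ e) ≠ (if b' = true then ζ e else !ζ e) := by
      intro b b' hbb'
      cases b <;> cases b' <;> simp at hbb' ⊢
    exact key _ _ hne h2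
  · have h1 := hb.decoRealRR_rr_edge (ω := ω) he
    have h2 := hb.decoRealRR_rr_edge (ω := ω') he
    rw [heq] at h1
    by_contra hne
    cases hω : ω (Sum.inr ⟨e, he⟩) with
    | true =>
      have := h2.1 (h1.2 hω)
      rw [hω] at hne; exact hne this.symm
    | false =>
      have h3 : ω' (Sum.inr ⟨e, he⟩) ≠ true := fun h' => by
        have := h1.1 (h2.2 h'); rw [hω] at this; simp at this
      have h3' : ω' (Sum.inr ⟨e, he⟩) = false := Bool.eq_false_iff.mpr h3
      rw [hω, h3'] at hne; exact hne rfl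

end Base

end LocRows

end Summit.Ventures.PercRepro2
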